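import Summits.Ventures.HodgeRepro2.T6N43FockU2
import Mathlib.Analysis.InnerProductSpace.l2Space

/-!
# T6N43FockSpace — the Fock space at the compact place `τ′₁` IN HOST SHAPE: the polynomial Fock model
embedded in its Hilbert space `ℓ²(multi-indices)` with the Fock inner product (monomials orthogonal,
`‖w^α‖² = α!`)

FILED by seat t6-p6 (gen 19, wave 1; staged gen 15 as a continuation-readiness artefact for
the RS-N4.3 lane of the lead's DRAFT seat map, route/lead-tools/g9/SEATMAP-DRAFT.v3.md l. 28: «the
archimedean datum on the host (Bergman / Fock vectors …)»). The accepted kernel reads the compact place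
through «any linear map `ι` of the polynomial Fock space into a Hilbert space (the Fock inner product)»
(T6N43FockU2 / T6N43Explicit: the fields `E`, `ι`, `hι : ι Δ ≠ 0` of `N43Places.ExplicitU2`), and the
toys of record take `E = ℂ`, `ι = deltaCoeff`. This file supplies the HOST choice with no print input
beyond a definition: `E := ℓ²(FockIndex, ℂ)` (Mathlib's `lp (fun _ => ℂ) 2`, a Hilbert space — the
completion of the polynomials for the Fock inner product) and `ι := fockEmbed`, `p ↦ (α ↦ √(α!) · p_α)`,
so that `⟪ι p, ι q⟫ = ∑ α! · \overline{p_α} · q_α` (`inner_fockEmbed`): the monomials `w^α` are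
orthogonal with `‖w^α‖² = α!` (`inner_fockEmbed_monomial`) — the inner product of the Segal–Bargmann /
Fock space restricted to polynomials [cite: Hall 2013, Quantum Theory for Mathematicians, GTM 267, §14.4:
Definition 14.14 («The space 𝓗L²(ℂⁿ, μ_ħ) is also sometimes called the *Fock space*») and Proposition
14.15 («the space of holomorphic polynomials forms a dense subspace of the Segal–Bargmann space»; its
proof: «We claim that the terms in (14.28) are orthogonal» — the Taylor monomials), with the density
(14.25) μ_ħ(z) = (πħ)^{−n} e^{−|z|²/ħ}; layer book:hall2013-quantum-theory-mathematicians chunk pages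
p0279–p0281 (chunk layer, print pages unverified). The monomial norms `‖z^n‖² = ħ^{|n|} n!` (ħ = 1 here)
are the Gaussian-moment evaluation, NOT displayed in the cited text: the normalisation is DECLARED by
this definition, and THEOREM N4.3 consumes only `‖Δ‖ ≠ 0`] (DEFINITION class, TARGET-T6 §7(c), as
`zeta` / `fockActU2`; no display).
`fockEmbed` is injective (`fockEmbed_injective`), `fockEmbed Δ ≠ 0` (`fockEmbed_Delta_ne_zero`) and
`‖fockEmbed Δ‖² = 2` (`inner_fockEmbed_Delta`: the two monomials of `Δ`, each of weight `1`). Nothing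
here is a toy transfer to the host datum: the file fixes the three Fock-model arguments `(E, ι, hι)` of
the host-shaped bundles of T6N43HostCarriers (filed in WAVE 1, p437619) from a definition, leaving the
scalar / weight
parameters explicit. Axioms: {propext, Classical.choice, Quot.sound}. §8(d): uses an L-value-free
non-vanishing device: NO.

Filed in Tier-6 WAVE 1 as p437620 (ACCEPTED 2026-08-26T10:20:45Z, commit 221f5d7d5dbc); this v2 differs from the filed
bytes in this module docstring only — the «(staged)» tags on sibling files, all filed in WAVE 1, replaced by their
filing references (the PARK release clause, STATUS l. 12943 / l. 13037 (1)); every declaration byte-identical.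
-/

namespace Summit.Ventures.HodgeRepro2.T6

open MvPolynomial
open scoped InnerProductSpace

namespace N43Fock

/-- The multi-indices of the polynomial Fock space at `τ′₁`: `α : Fin 3 × Fin 2 →₀ ℕ`. -/
abbrev FockIndex : Type := Fin 3 × Fin 2 →₀ ℕ

/-- THE Fock space at `τ′₁` in host shape: `ℓ²(FockIndex, ℂ)`, the Hilbert space completion of the
polynomial Fock model for the Fock inner product (the Taylor coefficients of a Segal–Bargmann function,
weighted by `√(α!)` — Hall 2013 Prop. 14.15, its proof (14.28) and the line after it). -/
abbrev FockSpace : Type := lp (fun _ : FockIndex => ℂ) 2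

/-- `α! = ∏_i (α_i)!` — the squared Fock norm of the monomial `w^α` (ħ = 1; the normalisation declared
in the module docstring). -/
noncomputable def fockWeight (α : FockIndex) : ℝ := α.prod fun _ n => (n.factorial : ℝ)

/-- `α! > 0`. -/
theorem fockWeight_pos (α : FockIndex) : 0 < fockWeight α :=
  Finset.prod_pos fun _ _ => Nat.cast_pos.mpr (Nat.factorial_pos _)

/-- `fockWeight α = 1` when every exponent of `α` is `≤ 1` (square-free monomials). -/
theorem fockWeight_eq_one {α : FockIndex} (h : ∀ i, α i ≤ 1) : fockWeight α = 1 :=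
  Finset.prod_eq_one fun i _ => by
    show ((α i).factorial : ℝ) = 1
    rw [Nat.factorial_eq_one.mpr (h i)]
    simp

/-- `√(α!)`, the scaling of the `α`-th coefficient in the `ℓ²`-embedding. -/
noncomputable def fockScale (α : FockIndex) : ℝ := Real.sqrt (fockWeight α)

/-- `√(α!) > 0`. -/
theorem fockScale_pos (α : FockIndex) : 0 < fockScale α :=
  Real.sqrt_pos.mpr (fockWeight_pos α)

/-- `√(α!) ≠ 0` as a complex scalar. -/
theorem fockScale_ne_zero (α : FockIndex) : (fockScale α : ℂ) ≠ 0 :=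
  Complex.ofReal_ne_zero.mpr (fockScale_pos α).ne'

/-- `√(α!) · √(α!) = α!`. -/
theorem fockScale_mul_self (α : FockIndex) : fockScale α * fockScale α = fockWeight α :=
  Real.mul_self_sqrt (fockWeight_pos α).le

/-- The scaled coefficient function of a polynomial: `α ↦ √(α!) · p_α`. -/
noncomputable def fockFun (p : FockPoly) : FockIndex → ℂ :=
  fun α => (fockScale α : ℂ) * MvPolynomial.coeff α p

/-- The value of `fockFun p` at `α` (by definition). -/
theorem fockFun_apply (p : FockPoly) (α : FockIndex) :
    fockFun p α = (fockScale α : ℂ) * MvPolynomial.coeff α p := rfl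

/-- A polynomial has finitely many coefficients, so its scaled coefficient function is in `ℓ²`. -/
theorem fockFun_memℓp (p : FockPoly) : Memℓp (fockFun p) 2 := by
  refine memℓp_gen ?_
  refine summable_of_ne_finset_zero (s := p.support) fun α hα => ?_
  rw [fockFun_apply, MvPolynomial.notMem_support_iff.mp hα, mul_zero, norm_zero]
  exact Real.zero_rpow (by norm_num)

/-- The embedding of the polynomial Fock model into its Hilbert space `ℓ²(FockIndex, ℂ)`:
`p ↦ (α ↦ √(α!) · p_α)`, `ℂ`-linear. -/
noncomputable def fockEmbed : FockPoly →ₗ[ℂ] FockSpace where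
  toFun p := ⟨fockFun p, fockFun_memℓp p⟩
  map_add' p q := by
    apply lp.ext
    ext α
    simp only [lp.coeFn_add, Pi.add_apply]
    change fockFun (p + q) α = fockFun p α + fockFun q α
    simp only [fockFun_apply, MvPolynomial.coeff_add, mul_add]
  map_smul' c p := by
    apply lp.ext
    ext α
    simp only [RingHom.id_apply, lp.coeFn_smul, Pi.smul_apply, smul_eq_mul]
    change fockFun (c • p) α = c * fockFun p α
    simp only [fockFun_apply, MvPolynomial.coeff_smul, smul_eq_mul]
    ring

/-- The `α`-th coordinate of `fockEmbed p` is `√(α!) · p_α` (by definition). -/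
theorem fockEmbed_apply (p : FockPoly) (α : FockIndex) :
    fockEmbed p α = (fockScale α : ℂ) * MvPolynomial.coeff α p := rfl

/-- THE FOCK INNER PRODUCT on the polynomial model: `⟪ι p, ι q⟫ = ∑' α, α! · \overline{p_α} · q_α`
(the Segal–Bargmann inner product of Hall 2013 Def. 14.14 / Prop. 14.15 restricted to polynomials,
ħ = 1, in the orthogonal monomial basis). -/
theorem inner_fockEmbed (p q : FockPoly) :
    ⟪fockEmbed p, fockEmbed q⟫_ℂ =
      ∑' α : FockIndex, (fockWeight α : ℂ) * (starRingEnd ℂ) (MvPolynomial.coeff α p) *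
        MvPolynomial.coeff α q := by
  rw [lp.inner_eq_tsum]
  refine tsum_congr fun α => ?_
  rw [RCLike.inner_apply', fockEmbed_apply, fockEmbed_apply, map_mul, Complex.conj_ofReal,
    ← fockScale_mul_self]
  push_cast
  ring

/-- The monomials are ORTHOGONAL with `‖w^α‖² = α!`:
`⟪ι (a w^α), ι (b w^β)⟫ = α! · \overline a · b` if `α = β`, and `0` otherwise. -/
theorem inner_fockEmbed_monomial (α β : FockIndex) (a b : ℂ) :
    ⟪fockEmbed (monomial α a), fockEmbed (monomial β b)⟫_ℂ =
      if α = β then (fockWeight α : ℂ) * (starRingEnd ℂ) a * b else 0 := by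
  classical
  rw [inner_fockEmbed]
  have h : ∀ γ : FockIndex,
      (fockWeight γ : ℂ) * (starRingEnd ℂ) (MvPolynomial.coeff γ (monomial α a)) *
        MvPolynomial.coeff γ (monomial β b) =
      if γ = α then (if α = β then (fockWeight α : ℂ) * (starRingEnd ℂ) a * b else 0) else 0 := by
    intro γ
    simp only [MvPolynomial.coeff_monomial]
    by_cases hγα : γ = α
    · rw [if_pos hγα.symm, if_pos hγα]
      by_cases hαβ : α = β
      · rw [if_pos hαβ, if_pos (hαβ.symm.trans hγα.symm), hγα]
      · rw [if_neg hαβ, if_neg (fun hβγ => hαβ (hγα.symm.trans hβγ.symm)), mul_zero]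
    · rw [if_neg (Ne.symm hγα), if_neg hγα, map_zero, mul_zero, zero_mul]
  simp_rw [h]
  rw [tsum_ite_eq]

/-- The embedding is injective: the polynomial Fock model sits inside its Hilbert space. -/
theorem fockEmbed_injective : Function.Injective fockEmbed := by
  rw [← LinearMap.ker_eq_bot, LinearMap.ker_eq_bot']
  intro p hp
  apply MvPolynomial.ext
  intro α
  have h : fockEmbed p α = 0 := by rw [hp]; rfl
  rw [fockEmbed_apply] at h
  rcases mul_eq_zero.mp h with h0 | h0
  · exact absurd h0 (fockScale_ne_zero α)
  · simpa using h0

/-- `Δ ≠ 0` as a polynomial (its coefficient at `w₀₀ w₁₁` is `1`, `N43Toy.deltaCoeff_Delta`). -/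
theorem Delta_ne_zero : Delta ≠ 0 := by
  intro h
  have := N43Toy.deltaCoeff_Delta
  rw [h, map_zero] at this
  exact zero_ne_one this

/-- The Fock vector `φ_{A,τ′₁} = Δ` is non-zero in the Fock space: the `hι` field of the host bundle. -/
theorem fockEmbed_Delta_ne_zero : fockEmbed Delta ≠ 0 := by
  intro h
  exact Delta_ne_zero (fockEmbed_injective (by rw [h, map_zero]))

/-- The first multi-index of `Δ = w₀₀ w₁₁ − w₀₁ w₁₀`: the monomial `w₀₀ w₁₁`. -/
noncomputable def idx₀ : FockIndex :=
  Finsupp.single ((0 : Fin 3), (0 : Fin 2)) 1 + Finsupp.single ((1 : Fin 3), (1 : Fin 2)) 1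
/-- The second multi-index of `Δ`: the monomial `w₀₁ w₁₀`. -/
noncomputable def idx₁ : FockIndex :=
  Finsupp.single ((0 : Fin 3), (1 : Fin 2)) 1 + Finsupp.single ((1 : Fin 3), (0 : Fin 2)) 1

/-- `Δ = w^{idx₀} − w^{idx₁}` as a difference of two monomials. -/
theorem Delta_eq : Delta = monomial idx₀ 1 - monomial idx₁ 1 := by
  unfold Delta idx₀ idx₁
  rw [MvPolynomial.X, MvPolynomial.X, MvPolynomial.X, MvPolynomial.X, monomial_mul, monomial_mul,
    one_mul]

/-- The two multi-indices of `Δ` are distinct. -/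
theorem idx₀_ne_idx₁ : idx₀ ≠ idx₁ := by
  intro h
  have := DFunLike.congr_fun h ((0 : Fin 3), (0 : Fin 2))
  simp [idx₀, idx₁] at this

/-- `idx₀` is square-free (every exponent `≤ 1`). -/
theorem idx₀_le_one (i : Fin 3 × Fin 2) : idx₀ i ≤ 1 := by
  rcases i with ⟨a, b⟩
  fin_cases a <;> fin_cases b <;> simp [idx₀]

/-- `idx₁` is square-free (every exponent `≤ 1`). -/
theorem idx₁_le_one (i : Fin 3 × Fin 2) : idx₁ i ≤ 1 := by
  rcases i with ⟨a, b⟩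
  fin_cases a <;> fin_cases b <;> simp [idx₁]

/-- `‖ι Δ‖² = ⟪ι Δ, ι Δ⟫ = 2`: the two monomials of `Δ` are orthogonal, each of Fock norm `1`
(`0! · 1! · 1! = 1`). -/
theorem inner_fockEmbed_Delta : ⟪fockEmbed Delta, fockEmbed Delta⟫_ℂ = 2 := by
  classical
  rw [Delta_eq, map_sub, inner_sub_left, inner_sub_right, inner_sub_right,
    inner_fockEmbed_monomial, inner_fockEmbed_monomial, inner_fockEmbed_monomial,
    inner_fockEmbed_monomial]
  simp only [idx₀_ne_idx₁, idx₀_ne_idx₁.symm, if_true, if_false, map_one, mul_one,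
    fockWeight_eq_one idx₀_le_one, fockWeight_eq_one idx₁_le_one]
  norm_num

/-- `‖ι Δ‖ = √2`. -/
theorem norm_fockEmbed_Delta : ‖fockEmbed Delta‖ = Real.sqrt 2 := by
  rw [norm_eq_sqrt_re_inner (𝕜 := ℂ), inner_fockEmbed_Delta, RCLike.ofNat_re]

end N43Fock

end Summit.Ventures.HodgeRepro2.T6
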